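import Summits.RiemannHypothesis.RiemannHypothesis.Theorems.RuelleBandCofiniteCriticalLineStubIndexCalibration
import Literature.Analysis.OperatorTheory.KreinLangerDefinitizationProofs
import HarnessLib

set_option linter.dupNamespace false

/-!
# Evidence (lead c2): the bet of line `pontryagin-neutral-engine` IS the crux

The skeleton `Cruxes/CofiniteCriticalLine/Lines/pontryagin-neutral-engine.lean` defines (verbatim copy below)
`WeilIndexLE N` and `BoundedWeilIndex := ∃ N, WeilIndexLE N`, and registers the bet
`stub_weilIndexBounded : BoundedWeilIndex`.  The tree theorem
`boundedWeilIndex'_iff_cofiniteCriticalLine_of_krein` (p104589) with `KreinDefinitization_holds`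
(= `boundedWeilIndex'_iff_cofiniteCriticalLine`, p111167) says this is EQUIVALENT to the crux; the check
below is by definitional unfolding only (`Iff.rfl`-shaped coercion of the statement).
-/

noncomputable section

open scoped BigOperators

namespace Summit.RiemannHypothesis.RiemannHypothesis.Cruxes.CofiniteCriticalLine.PontryaginNeutralEngineEvidence

open Literature.NumberTheory.LFunctions

/-- Verbatim copy of the skeleton's `WeilIndexLE`. -/
def WeilIndexLE (N : ℕ) : Prop :=
  ∀ g : Fin (N + 1) → ℝ → ℂ, (∀ i, IsWeilTest (g i)) →
    ∃ c : Fin (N + 1) → ℂ, c ≠ 0 ∧ 0 ≤ (weilQuadratic (fun t => ∑ i, c i * g i t)).re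

/-- Verbatim copy of the skeleton's bet `BoundedWeilIndex`. -/
def BoundedWeilIndex : Prop := ∃ N : ℕ, WeilIndexLE N

/-- **The bet is the crux**: `BoundedWeilIndex ↔ CofiniteCriticalLine`, by the landed unconditional rung
(p104589 + `KreinDefinitization_holds`; = p111167), with no rewriting beyond unfolding the two definitions. -/
theorem boundedWeilIndex_iff_crux :
    BoundedWeilIndex ↔ Summit.RiemannHypothesis.RiemannHypothesis.Theses.RuelleBand.CofiniteCriticalLine :=
  Summit.RiemannHypothesis.RiemannHypothesis.Theorems.RuelleBandCofiniteCriticalLine.boundedWeilIndex'_iff_cofiniteCriticalLine_of_krein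
    Literature.Analysis.OperatorTheory.KreinDefinitization_holds

/-- Hence the skeleton's five-stub composition collapses to one line: the crux from the bet alone
(`cofiniteCriticalLine_of_boundedWeilIndex'`-shaped), the other four stubs being downstream decoration. -/
theorem crux_of_bet (hbet : BoundedWeilIndex) :
    Summit.RiemannHypothesis.RiemannHypothesis.Theses.RuelleBand.CofiniteCriticalLine :=
  boundedWeilIndex_iff_crux.1 hbet

end Summit.RiemannHypothesis.RiemannHypothesis.Cruxes.CofiniteCriticalLine.PontryaginNeutralEngineEvidence

end
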